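import Literature.NumberTheory.LFunctions.TaoLogElliottLogAvg
import Literature.NumberTheory.LFunctions.TaoLogElliottTheorem23
import HarnessLib

/-!
# Tao's log-averaged Elliott theorem: display (2.12) — short sums of `g₁` at `a𝐧` are small

Part of the proof DAG below the named fact `Literature.NumberTheory.LFunctions.Tao2016_theorem23_core` (Tao, Forum Math. Pi 4
(2016) e8, the proof of Theorem 2.3 from (2.10) on).  The hypothesis of the core argument is the
bound (2.10) on `∑_{x/ω<n≤x} (1/(Hn)) |∑_{j=1}^H g₁(n+j) e(jα)|` (`Literature.NumberTheory.LFunctions.logAvgShortExpSum`), i.e.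
(2.11): `𝔼 |∑_{j=1}^H g₁(𝐧+j) e(αj)| = o(H)`.  The endgame of §3 (`Literature.NumberTheory.LFunctions.Tao2016.endgame`,
`TaoLogElliottEndgame.lean`) needs it at the dilated integer `a𝐧`, display (2.12):
"By Fourier expansion (or by positivity) we may insert the constraint `1_{a|𝐧}` in the
left-hand side of (2.11) …, and thus by Lemma 2.5 we also have
`sup_α 𝔼 |∑_{j=1}^H g₁(a𝐧+j) e(αj)| = o_{H₋→∞}(H)`."  We PROVE this step with explicit constants:

* `wsum_div_logWeightSum_shortExpSum_mul_le` — if `∑_{x/ω<n≤x} |S_n|/(Hn) ≤ B`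
  (`S_n = ∑_{j≤H} g(n+j)e(jα)`, `|g| ≤ 1` on `ℕ₊`), then
  `𝔼 |S_{a𝐧}|/H = (∑_{x/ω<n≤x} |S_{an}|/(Hn)) / ∑_{x/ω<n≤x} 1/n ≤ a (B + 8 + 2 log a) / ∑_{x/ω<n≤x} 1/n`
  (positivity `1_{a∣𝐧} ≤ 1` and Lemma 2.5 with `q = a`, `r = 0`,
  `Literature.NumberTheory.LFunctions.Tao2016.norm_logAvg_filter_mod_sub_le`).

With (2.10), `B = C (log log H / log H) log ω` and `∑ 1/n ≥ log ω - 1`, the right side is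
`≪ a C log log H / log H + a log a / log A = o_{H₋→∞}(1)`, as printed.

## References
* T. Tao, Forum Math. Pi 4 (2016), e8; arXiv:1509.05422, §2: (2.10), (2.11), Lemma 2.5 and the
  display (2.12) following its proof.
-/

open Finset Real Complex

namespace Literature.NumberTheory.LFunctions

namespace Tao2016

/-- The expectation of a real random variable, through `logAvg` of its complexification.
[folklore] -/
theorem logAvg_ofReal (F : ℕ → ℝ) (x ω : ℝ) :
    logAvg (fun n => (F n : ℂ)) x ω =
      (((∑ n ∈ Ioc ⌊x / ω⌋₊ ⌊x⌋₊, F n / n) / logWeightSum x ω : ℝ) : ℂ) := by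
  unfold logAvg wsum
  push_cast
  rfl

/-- `|S_n| ≤ H` for `|g| ≤ 1` on the positive integers (`S_n = ∑_{j=1}^H g(n+j) e(jα)`).
[folklore] -/
theorem norm_shortExpSum_le_of_norm_le {g : ℕ → ℂ} (hg : ∀ n : ℕ, 1 ≤ n → ‖g n‖ ≤ 1) (n H : ℕ)
    (α : ℝ) : ‖shortExpSum g n H α‖ ≤ H := by
  unfold shortExpSum
  calc ‖∑ j ∈ Icc 1 H, g (n + j) * Complex.exp (2 * Real.pi * Complex.I * (j : ℂ) * (α : ℂ))‖
      ≤ ∑ j ∈ Icc 1 H, ‖g (n + j) * Complex.exp (2 * Real.pi * Complex.I * (j : ℂ) * (α : ℂ))‖ :=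
        norm_sum_le _ _
    _ ≤ ∑ j ∈ Icc 1 H, (1 : ℝ) := by
        refine sum_le_sum fun j hj => ?_
        rw [norm_mul]
        have h1 : ‖g (n + j)‖ ≤ 1 := hg _ (by have := (mem_Icc.1 hj).1; omega)
        have h2 : ‖Complex.exp (2 * Real.pi * Complex.I * (j : ℂ) * (α : ℂ))‖ = 1 := by
          have : 2 * Real.pi * Complex.I * (j : ℂ) * (α : ℂ) = ((2 * Real.pi * j * α : ℝ) : ℂ) * Complex.I := by
            push_cast; ring
          rw [this, Complex.norm_exp_ofReal_mul_I]
        rw [h2, mul_one]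
        exact h1
    _ = H := by simp

/-- **Tao 2016, display (2.12)** (from (2.10)/(2.11) by positivity and Lemma 2.5).  Let
`|g| ≤ 1` on `ℕ₊`, `a ≥ 1`, `H ≥ 1`, and suppose (2.10) at the frequency `α`:
`∑_{x/ω<n≤x} |S_n| / (H n) ≤ B`, `S_n = ∑_{j=1}^H g(n+j) e(jα)`.  Then, on a non-degenerate
range (`∑_{x/ω<n≤x} 1/n > 0`),
`𝔼 |S_{a𝐧}| / H = (∑_{x/ω<n≤x} |S_{an}| / (H n)) / ∑ 1/n ≤ a (B + 8 + 2 log a) / ∑_{x/ω<n≤x} 1/n`.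
[cite: TaoFMP2016, §2 (2.12)] -/
theorem wsum_div_logWeightSum_shortExpSum_mul_le {g : ℕ → ℂ} (hg : ∀ n : ℕ, 1 ≤ n → ‖g n‖ ≤ 1)
    {a H : ℕ} (ha : 1 ≤ a) (hH : 1 ≤ H) {x ω : ℝ} (hS : 0 < logWeightSum x ω) (α : ℝ) {B : ℝ}
    (h210 : logAvgShortExpSum g x ω H α ≤ B) :
    (∑ n ∈ Ioc ⌊x / ω⌋₊ ⌊x⌋₊, ‖shortExpSum g (a * n) H α‖ / ((H : ℝ) * n)) / logWeightSum x ω ≤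
      a * (B + 8 + 2 * Real.log a) / logWeightSum x ω := by
  -- the `[0,1]`-valued random variable `f(n) = |S_n| / H`
  set f : ℕ → ℝ := fun n => ‖shortExpSum g n H α‖ / H with hf
  have hH0 : (0 : ℝ) < H := by exact_mod_cast hH
  have hf0 : ∀ n, 0 ≤ f n := fun n => by positivity
  have hf1 : ∀ n, f n ≤ 1 := fun n => by
    rw [hf, div_le_one hH0]; exact norm_shortExpSum_le_of_norm_le hg n H α
  set X : ℕ → ℂ := fun n => (f n : ℂ) with hX
  have hXb : ∀ n, ‖X n‖ ≤ 1 := fun n => by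
    rw [hX]; simp only [Complex.norm_real, Real.norm_eq_abs, abs_of_nonneg (hf0 n)]; exact hf1 n
  -- Lemma 2.5 with `q = a`, `r = 0`
  have ha0 : 0 < a := ha
  have h25 := norm_logAvg_filter_mod_sub_le hXb ha0 ha0 hS (x := x) (ω := ω)
  -- both expectations are real: name them
  set E₁ : ℝ := (∑ n ∈ Ioc ⌊x / ω⌋₊ ⌊x⌋₊, (if n % a = 0 then f n else 0) / n) / logWeightSum x ω
    with hE₁
  set E₂ : ℝ := (∑ n ∈ Ioc ⌊x / ω⌋₊ ⌊x⌋₊, f (a * n + 0) / n) / logWeightSum x ω with hE₂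
  have e1 : logAvg (fun n => if n % a = 0 then X n else 0) x ω = (E₁ : ℂ) := by
    have : (fun n => if n % a = 0 then X n else 0) =
        fun n => (((if n % a = 0 then f n else 0 : ℝ)) : ℂ) := by
      funext n; split_ifs <;> simp [hX]
    rw [this, logAvg_ofReal]
  have e2 : logAvg (fun n => X (a * n + 0)) x ω = (E₂ : ℂ) := by
    have : (fun n => X (a * n + 0)) = fun n => ((f (a * n + 0) : ℝ) : ℂ) := by funext n; rfl
    rw [this, logAvg_ofReal]
  rw [e1, e2, show (1 : ℂ) / (a : ℂ) * (E₂ : ℂ) = ((E₂ / a : ℝ) : ℂ) by push_cast; ring,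
    ← Complex.ofReal_sub, Complex.norm_real, Real.norm_eq_abs] at h25
  -- `E₂ / a ≤ E₁ + error`, and `E₁ ≤ 𝔼 f ≤ B / S` by positivity
  have hE₂le : E₂ / a ≤ E₁ + (8 + 2 * Real.log a) / logWeightSum x ω := by
    have := (abs_le.1 h25).1; linarith
  have hE₁le : E₁ ≤ B / logWeightSum x ω := by
    rw [hE₁]
    refine div_le_div_of_nonneg_right ?_ hS.le
    calc ∑ n ∈ Ioc ⌊x / ω⌋₊ ⌊x⌋₊, (if n % a = 0 then f n else 0) / (n : ℝ)
        ≤ ∑ n ∈ Ioc ⌊x / ω⌋₊ ⌊x⌋₊, f n / n := by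
          refine sum_le_sum fun n _ => div_le_div_of_nonneg_right ?_ (Nat.cast_nonneg _)
          split_ifs
          · exact le_rfl
          · exact hf0 n
      _ = logAvgShortExpSum g x ω H α := by
          unfold logAvgShortExpSum
          refine sum_congr rfl fun n _ => ?_
          rw [hf]; simp only; rw [div_div]
      _ ≤ B := h210
  -- the target is `E₂`
  have htarget : (∑ n ∈ Ioc ⌊x / ω⌋₊ ⌊x⌋₊, ‖shortExpSum g (a * n) H α‖ / ((H : ℝ) * n)) /
      logWeightSum x ω = E₂ := by
    rw [hE₂]
    congr 1
    refine sum_congr rfl fun n _ => ?_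
    rw [hf]; simp only; rw [add_zero, div_div]
  rw [htarget]
  have haR : (1 : ℝ) ≤ a := by exact_mod_cast ha
  have haR0 : (0 : ℝ) < a := by linarith
  calc E₂ = a * (E₂ / a) := by field_simp
    _ ≤ a * (B / logWeightSum x ω + (8 + 2 * Real.log a) / logWeightSum x ω) :=
        mul_le_mul_of_nonneg_left (by linarith) haR0.le
    _ = a * (B + 8 + 2 * Real.log a) / logWeightSum x ω := by
        field_simp
        ring

end Tao2016

end Literature.NumberTheory.LFunctions
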